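import Summits.ResolutionOfSingularities.ResolutionOfSingularities.Theorems.FrobeniusClosingPatchingRelPerfectDepthSNCPointwiseTransport
import Literature.AlgebraicGeometry.Resolution.MonomialOrderReductionUnit
import HarnessLib

/-!
# Crux `PatchingRelPerfect` (stmt-ResolutionOfSingularities-16161), chain W5.2 — TargetsF5J, S-target
# `PointwisePairGame`, part 1: the transform of a monomial ideal along a stratum, with simple normal
# crossings read only AT THE POINTS OF THE CENTRE

[OURS · L1 W5.2 · rung tool] Replaces the role of NO printed item; NOT a statement of the manuscript under
review; fact-free, any dimension, no base field, no excellence.  The tree's transform formulas for monomial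
ideals along the blow-up of a stratum `C = ∑_{K ∈ T} K` of the boundary (`MonomialMarkedIdealsBlowup.lean`:
`map_stalkIdeal_eq_mul_of_mem`, `map_stalkIdeal_eq_of_not_mem`, `comap_monomialIdeal`, and the incidences
`exists_not_mem_support_strictTransformIdeal`, `strictTransformIdeal_ne_comap`, `eq_of_strictTransformIdeal_eq`)
take the GLOBAL hypothesis `HasSNC Es`, but READ it only through `exists_chartData` at the image point
`π x' ∈ V(C)` (and, for the last one, at `π x'`).  This file re-derives them VERBATIM from the POINTWISE
hypothesis `∀ x ∈ W, SNCWithAt Es ⊤ x` on a set `W ⊇ V(C)` (res-D-pv-009's `DepthSNC.SNCWithAt`, fed by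
`DepthSNC.exists_chartData_of_sncWithAt`), together with the two pointwise book-keeping facts
`SNCWithAt.finsetSup` (a stratum has simple normal crossings with the boundary at a point) and
`isRegular_subscheme_finsetSup_of_sncWithAt` (a stratum met by the boundary with simple normal crossings at
each of ITS points is a regular scheme).

USE (W5.2, plan-1 g7 RE-KEY 07:57:17Z): the S-target `DepthTargets.PointwisePairGame` of
`…DepthMixedTargetsJ` — stub-4's pair game (`MonomialCleanup.exists_centreSeq_isLocallyPrincipal_comap`,
p504028) with simple normal crossings asked only AT THE POINTS OF THE COSUPPORT; parts 2 (the step) and 3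
(the induction and the by-name closure) follow in companion files (400-line rule).  The open-neighbourhood
shortcut through `DepthTargets.localPairGame_holds` (p511765) is not available in this generality: it needs
the snc locus to be open near the cosupport, i.e. upper semicontinuity of orders, which the tree has only on
excellent schemes (`isClosed_setOf_le_idealOrder`).

## References
* J. Kollár, *Lectures on Resolution of Singularities* (2007), (3.111) Step 3, Def. 3.25. [Kollar2007]
* E. Bierstone, D. Grigoriev, P. Milman, J. Włodarczyk, arXiv:1206.3090, Def. 3.1.1, Def. 3.1.3 (2), §4 Step 2b.
  [BierstoneGrigorievMilmanWlodarczyk2011]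
* The Stacks Project, Tags 0804, 02OS. [StacksProject]
-/

-- `Summit.<Summit>.<Sub>.Theorems` with `Sub = Summit` (single-conjunct summit, D-0017)
set_option linter.dupNamespace false

noncomputable section

open CategoryTheory AlgebraicGeometry TopologicalSpace IsLocalRing
open Literature.AlgebraicGeometry.Resolution

namespace Summit.ResolutionOfSingularities.ResolutionOfSingularities.Theorems

universe u

namespace PointwisePair

open DepthSNC

/-! ## §1 Pointwise book-keeping: strata -/

section Strata

variable {X : Scheme.{u}} {Es : List X.IdealSheafData}

/-- **A stratum of the boundary has simple normal crossings with it, at a point** (pointwise form of the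
tree's `HasSNC.hasSNCWith_finsetSup`): at `x ∈ ⋂_{K∈T} V(K)` the stalk of `∑_{K∈T} K` is generated by the
parameters attached to the members of `T`. [cite: Kollar2007, (3.111) Step 3 with Def. 3.25] -/
theorem _root_.Summit.ResolutionOfSingularities.ResolutionOfSingularities.Theorems.DepthSNC.SNCWithAt.finsetSup
    {x : X} (h : SNCWithAt Es ⊤ x) (T : Finset X.IdealSheafData) (hT : ∀ K ∈ T, K ∈ Es) :
    SNCWithAt Es (T.sup id) x := by
  classical
  obtain ⟨hreg, d, u, hd, hu, ⟨ι, hιinj, hι⟩, -⟩ := h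
  refine ⟨hreg, d, u, hd, hu, ⟨ι, hιinj, hι⟩, fun hx => ?_⟩
  rw [mem_support_finsetSup_iff] at hx
  refine ⟨(fun K : T => ι ⟨K.1, hT K.1 K.2, hx K.1 K.2⟩) '' Set.univ, ?_⟩
  rw [stalkIdeal_finsetSup, Set.image_image, Set.image_univ]
  have h1 : (T.sup fun K => stalkIdeal K x) =
      T.attach.sup fun K : T => Ideal.span {u (ι ⟨K.1, hT K.1 K.2, hx K.1 K.2⟩)} := by
    rw [← Finset.sup_attach]
    exact Finset.sup_congr rfl fun K _ => hι ⟨K.1, hT K.1 K.2, hx K.1 K.2⟩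
  rw [h1, Finset.sup_span_singleton_eq_span_image, Finset.coe_attach, Set.image_univ]

/-- A centre having simple normal crossings with a boundary AT a point of it is rsop-generated there.
[folklore] -/
theorem _root_.Summit.ResolutionOfSingularities.ResolutionOfSingularities.Theorems.DepthSNC.SNCWithAt.isRsopGeneratedAt
    {C : X.IdealSheafData} {x : X} (h : SNCWithAt Es C x) (hx : x ∈ C.support) :
    IsRsopGeneratedAt C x := by
  obtain ⟨hreg, d, u, hd, hu, -, hC⟩ := h
  subst hd
  exact ⟨hreg, u, hu, hC hx⟩

/-- **A stratum of a boundary having simple normal crossings at each point OF THE STRATUM is a regular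
scheme** (pointwise form of `HasSNC.isRegular_subscheme_finsetSup`; Matsumura Thm. 14.2 at each point).
[cite: Kollar2007, (3.111) Step 3] -/
theorem isRegular_subscheme_finsetSup_of_sncWithAt [IsLocallyNoetherian X] (T : Finset X.IdealSheafData)
    (hT : ∀ K ∈ T, K ∈ Es) (hW : ∀ x ∈ (T.sup id).support, SNCWithAt Es ⊤ x) :
    Scheme.IsRegular (T.sup id).subscheme :=
  isRegular_subscheme_of_isRsopGeneratedAt fun x hx => ((hW x hx).finsetSup T hT).isRsopGeneratedAt hx

/-- Under simple normal crossings AT `x`, the members through `x` have stalks generated by order-one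
elements (pointwise form of `HasSNC.exists_generator_of_mem`). [folklore] -/
theorem exists_generator_of_mem_of_sncWithAt {x : X} (h : SNCWithAt Es ⊤ x)
    {K : X.IdealSheafData} (hK : K ∈ Es) (hx : x ∈ K.support) :
    ∃ f : X.presheaf.stalk x, f ∈ maximalIdeal _ ∧ f ∉ maximalIdeal _ ^ 2 ∧
      stalkIdeal K x = Ideal.span {f} := by
  obtain ⟨hreg, d, u, hd, hu, ⟨ι, -, hι⟩, -⟩ := h
  haveI := hreg
  have hrsop : IsRsopPart (u ∘ id) := isRsopPart_comp_of_rsop hd u hu id Function.injective_id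
  exact ⟨u (ι ⟨K, hK, hx⟩), hrsop.mem_maximalIdeal _, hrsop.not_mem_sq _, hι ⟨K, hK, hx⟩⟩

end Strata

/-! ## §2 The stalk identities of the transform, reading snc at the points of the centre -/

section Stalks

variable {X X' : Scheme.{u}} [IsLocallyNoetherian X] {π : X' ⟶ X} {Es : List X.IdealSheafData}
  {T : Finset X.IdealSheafData}

/-- **`π^* 𝓘_K = 𝓘(F) · K'` on stalks for a member `K` of `T`**, snc read at the points of the centre.
[cite: Kollar2007, (3.111) Step 3] -/
theorem map_stalkIdeal_eq_mul_of_mem_pw (hW : ∀ x ∈ (T.sup id).support, SNCWithAt Es ⊤ x)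
    (hT : ∀ K ∈ T, K ∈ Es) (hπ : IsBlowup π (T.sup id)) {K : X.IdealSheafData} (hK : K ∈ T) (x' : X') :
    (stalkIdeal K (π x')).map (π.stalkMap x').hom =
      stalkIdeal (strictTransformIdeal π (T.sup id) K) x' * stalkIdeal ((T.sup id).comap π) x' := by
  haveI : IsProper π := hπ.isProper
  haveI : IsLocallyNoetherian X' := LocallyOfFiniteType.isLocallyNoetherian π
  by_cases hxC : π x' ∈ (T.sup id).support
  · obtain ⟨D, τ, hτinj, hτ⟩ :=
      exists_chartData_of_sncWithAt hπ x' ((hW _ hxC).finsetSup T hT) hxC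
    letI := D.algB
    have hx : π x' ∈ K.support := (mem_support_finsetSup_iff T _).mp hxC K hK
    obtain ⟨j, hj⟩ := D.exists_eq_inl_of_mem τ hτ hT hK hx
    have hKx : stalkIdeal K (π x') = Ideal.span {(X.presheaf.germ D.U (π x') D.hxU).hom (D.x j)} := by
      rw [hτ ⟨K, hT K hK, hx⟩, hj, Sum.elim_inl]
    rw [D.stalkIdeal_exceptional hxC, hKx, Ideal.map_span, Set.image_singleton,
      ← D.algebraMap_reesChartBase, ← D.toStalk_eq]
    by_cases hji : j = D.i
    · subst hji
      rw [D.stalkIdeal_strictTransform_x_self hxC K hKx, Ideal.top_mul]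
    · rw [D.stalkIdeal_strictTransform_x hxC K hji hKx, Ideal.span_singleton_mul_span_singleton,
        D.toStalk_reesChartBase_x j]
  · have htop : stalkIdeal ((T.sup id).comap π) x' = ⊤ := by
      apply stalkIdeal_eq_top_of_not_mem_support
      rwa [Scheme.IdealSheafData.support_comap]
    rw [stalkIdeal_strictTransformIdeal_of_not_mem_support _ K hxC, htop, Ideal.mul_top]

/-- **`π^* 𝓘_K = K'` on stalks for a boundary divisor `K ∉ T`**, snc read at the points of the centre.
[cite: Kollar2007, (3.111) Step 3] -/
theorem map_stalkIdeal_eq_of_not_mem_pw (hW : ∀ x ∈ (T.sup id).support, SNCWithAt Es ⊤ x)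
    (hT : ∀ K ∈ T, K ∈ Es) (hπ : IsBlowup π (T.sup id)) {K : X.IdealSheafData} (hKE : K ∈ Es) (hK : K ∉ T)
    (x' : X') :
    (stalkIdeal K (π x')).map (π.stalkMap x').hom = stalkIdeal (strictTransformIdeal π (T.sup id) K) x' := by
  haveI : IsProper π := hπ.isProper
  haveI : IsLocallyNoetherian X' := LocallyOfFiniteType.isLocallyNoetherian π
  by_cases hxC : π x' ∈ (T.sup id).support
  · by_cases hx : π x' ∈ K.support
    · obtain ⟨D, τ, hτinj, hτ⟩ :=
        exists_chartData_of_sncWithAt hπ x' ((hW _ hxC).finsetSup T hT) hxC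
      letI := D.algB
      obtain ⟨m, hm⟩ := D.exists_eq_inr_of_not_mem τ hτ hτinj hT hxC hKE hK hx
      have hKx : stalkIdeal K (π x') = Ideal.span {(X.presheaf.germ D.U (π x') D.hxU).hom (D.w m)} := by
        rw [hτ ⟨K, hKE, hx⟩, hm, Sum.elim_inr]
      rw [D.stalkIdeal_strictTransform_w hxC K m hKx, hKx, Ideal.map_span, Set.image_singleton,
        ← D.algebraMap_reesChartBase, ← D.toStalk_eq]
    · apply le_antisymm
      · rw [← stalkIdeal_comap_eq_map_stalkMap]
        exact stalkIdeal_mono ((comap_le_controlledTransform π (T.sup id) K 1).trans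
          (controlledTransform_le_strictTransformIdeal π (T.sup id) K 1)) x'
      · rw [stalkIdeal_eq_top_of_not_mem_support hx, Ideal.map_top]
        exact le_top
  · rw [stalkIdeal_strictTransformIdeal_of_not_mem_support _ K hxC]

end Stalks

/-! ## §3 The total transform of the monomial ideal -/

section Transform

variable {X X' : Scheme.{u}} [IsLocallyNoetherian X] {π : X' ⟶ X}
  {E : List (X.IdealSheafData × ℕ)} {T : Finset X.IdealSheafData}

/-- **`π^*(Π_j 𝓘_{E^j}^{a_j}) = 𝓘(F)^{∑_{E^j∈T} a_j} · Π_j ((E^j)')^{a_j}`**, snc read at the points of the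
centre. [cite: Kollar2007, (3.111) Step 3] [cite: BierstoneGrigorievMilmanWlodarczyk2011, §4 Step 2b] -/
theorem comap_monomialIdeal_pw (hW : ∀ x ∈ (T.sup id).support, SNCWithAt (boundaryOf E) ⊤ x)
    (hT : ∀ K ∈ T, K ∈ boundaryOf E) (hπ : IsBlowup π (T.sup id)) :
    (monomialIdeal E).comap π = (T.sup id).comap π ^ weightOf E T *
      monomialIdeal (E.map fun p => (strictTransformIdeal π (T.sup id) p.1, p.2)) := by
  classical
  refine ext_of_forall_stalkIdeal_eq fun x' => ?_
  rw [stalkIdeal_comap_eq_map_stalkMap, stalkIdeal_mul, stalkIdeal_pow]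
  -- by induction on the sub-lists of `E`
  suffices h : ∀ E₀ : List (X.IdealSheafData × ℕ), (∀ p ∈ E₀, p ∈ E) →
      (stalkIdeal (monomialIdeal E₀) (π x')).map (π.stalkMap x').hom =
        stalkIdeal ((T.sup id).comap π) x' ^ weightOf E₀ T *
          stalkIdeal (monomialIdeal (E₀.map fun p => (strictTransformIdeal π (T.sup id) p.1, p.2))) x' from
    h E fun _ hp => hp
  intro E₀ hE₀
  induction E₀ with
  | nil =>
    rw [monomialIdeal_nil, List.map_nil, monomialIdeal_nil, stalkIdeal_top, stalkIdeal_top,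
      Ideal.map_top, weightOf_nil, pow_zero, one_mul]
  | cons p E₀ ih =>
    rw [monomialIdeal_cons, List.map_cons, monomialIdeal_cons, stalkIdeal_mul, stalkIdeal_pow,
      stalkIdeal_mul, stalkIdeal_pow, Ideal.map_mul, Ideal.map_pow,
      ih fun q hq => hE₀ q (List.mem_cons_of_mem _ hq), weightOf_cons]
    have hpE : p.1 ∈ boundaryOf E := fst_mem_boundaryOf (hE₀ p (List.mem_cons_self ..))
    by_cases hpT : p.1 ∈ T
    · rw [if_pos hpT, map_stalkIdeal_eq_mul_of_mem_pw hW hT hπ hpT x', pow_add, mul_pow]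
      simp only []
      ring
    · rw [if_neg hpT, map_stalkIdeal_eq_of_not_mem_pw hW hT hπ hpE hpT x', zero_add]
      simp only []
      ring

/-- The total transform of the monomial ideal is the monomial ideal of `transformExp E π T 0`, snc read
at the points of the centre. [cite: Kollar2007, (3.111) Step 3] -/
theorem comap_monomialIdeal_eq_transformExp_pw (hW : ∀ x ∈ (T.sup id).support, SNCWithAt (boundaryOf E) ⊤ x)
    (hT : ∀ K ∈ T, K ∈ boundaryOf E) (hπ : IsBlowup π (T.sup id)) :
    (monomialIdeal E).comap π = monomialIdeal (transformExp E π T 0) := by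
  rw [comap_monomialIdeal_pw hW hT hπ, transformExp, monomialIdeal_append, monomialIdeal_singleton,
    Nat.sub_zero, mul_comm]

end Transform

/-! ## §4 Incidences of the transformed boundary -/

section Incidence

variable {X X' : Scheme.{u}} [IsLocallyNoetherian X] {π : X' ⟶ X} {Es : List X.IdealSheafData}
  {T : Finset X.IdealSheafData}

/-- Over the centre, at every point of the blow-up some member of `T` has trivial strict transform, snc
read at the points of the centre. [cite: Kollar2007, (3.111) Step 3] -/
theorem exists_stalkIdeal_strictTransformIdeal_eq_top_pw (hW : ∀ x ∈ (T.sup id).support, SNCWithAt Es ⊤ x)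
    (hT : ∀ K ∈ T, K ∈ Es) (hπ : IsBlowup π (T.sup id)) {x' : X'} (hxC : π x' ∈ (T.sup id).support) :
    ∃ K ∈ T, stalkIdeal (strictTransformIdeal π (T.sup id) K) x' = ⊤ := by
  haveI : IsProper π := hπ.isProper
  haveI : IsLocallyNoetherian X' := LocallyOfFiniteType.isLocallyNoetherian π
  obtain ⟨D, τ, -, hτ⟩ := exists_chartData_of_sncWithAt hπ x' ((hW _ hxC).finsetSup T hT) hxC
  obtain ⟨K, hK, hj⟩ := D.exists_mem_eq_inl τ hτ hT hxC D.i
  refine ⟨K, hK, D.stalkIdeal_strictTransform_x_self hxC K ?_⟩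
  rw [hτ ⟨K, hT K hK, (mem_support_finsetSup_iff T _).mp hxC K hK⟩, hj, Sum.elim_inl]

/-- Hence no point of the exceptional divisor lies on the strict transforms of all members of `T`, snc read
at the points of the centre. [cite: Kollar2007, (3.111) Step 3] -/
theorem exists_not_mem_support_strictTransformIdeal_pw (hW : ∀ x ∈ (T.sup id).support, SNCWithAt Es ⊤ x)
    (hT : ∀ K ∈ T, K ∈ Es) (hπ : IsBlowup π (T.sup id)) {x' : X'}
    (hx' : x' ∈ ((T.sup id).comap π).support) :
    ∃ K ∈ T, x' ∉ (strictTransformIdeal π (T.sup id) K).support := by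
  have hxC : π x' ∈ (T.sup id).support := by
    have h : x' ∈ (((T.sup id).comap π).support : Set X') := hx'
    rwa [Scheme.IdealSheafData.support_comap] at h
  obtain ⟨K, hK, htop⟩ := exists_stalkIdeal_strictTransformIdeal_eq_top_pw hW hT hπ hxC
  refine ⟨K, hK, fun h => ?_⟩
  have hle := (mem_support_iff_stalkIdeal_le _ _).mp h
  rw [htop, top_le_iff] at hle
  exact (maximalIdeal.isMaximal _).ne_top hle

/-- **The stalks of the strict transforms at a point over the centre** (trivial, or generated by the member
of the regular system of parameters of `𝒪_{X',x'}` coded by the label of the old divisor, the coding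
`Fin D.a ⊕ D.GoodGen → Fin D.r ⊕ Fin D.a` written inline), snc read at the points of the centre. [cite: Kollar2007, Def. 3.25] -/
private theorem stalkIdeal_strictTransformIdeal_cases_pw (hW : ∀ x ∈ (T.sup id).support, SNCWithAt Es ⊤ x)
    (hT : ∀ K ∈ T, K ∈ Es) (hπ : IsBlowup π (T.sup id)) {x' : X'} (hxC : π x' ∈ (T.sup id).support) :
    ∃ (D : ChartData π (T.sup id) x') (τ : {K : X.IdealSheafData // K ∈ Es ∧ π x' ∈ K.support} →
        Fin D.r ⊕ Fin D.a) (d : ℕ) (v : Fin d → X'.presheaf.stalk x')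
        (lab : Option (Fin D.a ⊕ D.GoodGen) → Fin d),
      Function.Injective τ ∧ IsRsopPart v ∧ Function.Injective lab ∧
      stalkIdeal ((T.sup id).comap π) x' = Ideal.span {v (lab none)} ∧
      ∀ K, stalkIdeal (strictTransformIdeal π (T.sup id) K.1) x' = ⊤ ∨
        ∃ l : Fin D.a ⊕ D.GoodGen, Sum.elim (fun m => Sum.inr m) (fun j => Sum.inl j.1) l = τ K ∧
          stalkIdeal (strictTransformIdeal π (T.sup id) K.1) x' = Ideal.span {v (lab (some l))} := by
  haveI : IsProper π := hπ.isProper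
  haveI : IsLocallyNoetherian X' := LocallyOfFiniteType.isLocallyNoetherian π
  obtain ⟨D, τ, hτinj, hτ⟩ := exists_chartData_of_sncWithAt hπ x' ((hW _ hxC).finsetSup T hT) hxC
  obtain ⟨hregS, d, v, hsf, hspan, lab, hlabinj, hv0, hvw, hve⟩ := D.exists_rsop hxC
  haveI := hregS
  have hrsop : IsRsopPart (v ∘ id) := isRsopPart_comp_of_rsop hsf v hspan id Function.injective_id
  refine ⟨D, τ, d, v, lab, hτinj, hrsop, hlabinj, by rw [hv0]; exact D.stalkIdeal_exceptional hxC,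
    fun K => ?_⟩
  letI := D.algB
  rcases hl : τ K with j | m
  · have hKx : stalkIdeal K.1 (π x') = Ideal.span {(X.presheaf.germ D.U (π x') D.hxU).hom (D.x j)} := by
      rw [hτ K, hl, Sum.elim_inl]
    by_cases hji : j = D.i
    · subst hji
      exact Or.inl (D.stalkIdeal_strictTransform_x_self hxC K.1 hKx)
    · have hst := D.stalkIdeal_strictTransform_x hxC K.1 hji hKx
      by_cases hQ : D.gen j ∈ D.Q
      · refine Or.inr ⟨Sum.inr ⟨j, hji, hQ⟩, rfl, ?_⟩
        rw [hst, hve]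
      · left
        rw [hst, Ideal.span_singleton_eq_top]
        by_contra hu
        exact hQ ((D.chartGen_mem_Q_iff j).mpr ((mem_maximalIdeal _).mpr hu))
  · have hKx : stalkIdeal K.1 (π x') = Ideal.span {(X.presheaf.germ D.U (π x') D.hxU).hom (D.w m)} := by
      rw [hτ K, hl, Sum.elim_inr]
    refine Or.inr ⟨Sum.inl m, rfl, ?_⟩
    rw [D.stalkIdeal_strictTransform_w hxC K.1 m hKx, hvw]

/-- **A strict transform is never the (non-empty) exceptional divisor**, snc read at the points of the
centre. [folklore] -/
theorem strictTransformIdeal_ne_comap_pw (hW : ∀ x ∈ (T.sup id).support, SNCWithAt Es ⊤ x)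
    (hT : ∀ K ∈ T, K ∈ Es) (hπ : IsBlowup π (T.sup id)) {K : X.IdealSheafData} (hKE : K ∈ Es) {x' : X'}
    (hx' : x' ∈ ((T.sup id).comap π).support) :
    strictTransformIdeal π (T.sup id) K ≠ (T.sup id).comap π := by
  haveI : IsProper π := hπ.isProper
  haveI : IsLocallyNoetherian X' := LocallyOfFiniteType.isLocallyNoetherian π
  have hxC : π x' ∈ (T.sup id).support := by
    have h : x' ∈ (((T.sup id).comap π).support : Set X') := hx'
    rwa [Scheme.IdealSheafData.support_comap] at h
  have hFle := (mem_support_iff_stalkIdeal_le _ _).mp hx'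
  have hFne : stalkIdeal ((T.sup id).comap π) x' ≠ ⊤ := fun h =>
    (maximalIdeal.isMaximal _).ne_top (top_le_iff.mp (h ▸ hFle))
  intro heq
  by_cases hx : π x' ∈ K.support
  · obtain ⟨D, τ, d, v, lab, -, hrsop, hlabinj, hF, hcases⟩ :=
      stalkIdeal_strictTransformIdeal_cases_pw hW hT hπ hxC
    haveI := hrsop.isRegularLocalRing
    haveI := isDomain_of_isRegularLocalRing (X'.presheaf.stalk x')
    rcases hcases ⟨K, hKE, hx⟩ with htop | ⟨l, -, hl⟩
    · exact hFne (heq ▸ htop)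
    · rw [heq, hF, Ideal.span_singleton_eq_span_singleton] at hl
      exact hrsop.not_associated (fun h => by cases hlabinj h) hl
  · apply hFne
    rw [← heq]
    refine top_le_iff.mp ?_
    rw [← Ideal.map_top (π.stalkMap x').hom, ← stalkIdeal_eq_top_of_not_mem_support hx,
      ← stalkIdeal_comap_eq_map_stalkMap]
    exact stalkIdeal_mono ((comap_le_controlledTransform π (T.sup id) K 1).trans
      (controlledTransform_le_strictTransformIdeal π (T.sup id) K 1)) x'

/-- **Members with the same non-empty strict transform are equal**, snc read at the points of the centre and
at the image of the witness point. [folklore] -/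
theorem eq_of_strictTransformIdeal_eq_pw (hW : ∀ x ∈ (T.sup id).support, SNCWithAt Es ⊤ x)
    (hT : ∀ K ∈ T, K ∈ Es) (hπ : IsBlowup π (T.sup id)) {K₁ K₂ : X.IdealSheafData} (h₁ : K₁ ∈ Es)
    (h₂ : K₂ ∈ Es) {x' : X'} (hx'W : SNCWithAt Es ⊤ (π x'))
    (hx' : x' ∈ (strictTransformIdeal π (T.sup id) K₁).support)
    (heq : strictTransformIdeal π (T.sup id) K₁ = strictTransformIdeal π (T.sup id) K₂) :
    K₁ = K₂ := by
  haveI : IsProper π := hπ.isProper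
  haveI : IsLocallyNoetherian X' := LocallyOfFiniteType.isLocallyNoetherian π
  have hx₁ : π x' ∈ K₁.support := mem_support_of_mem_support_strictTransformIdeal hx'
  have hx₂ : π x' ∈ K₂.support := mem_support_of_mem_support_strictTransformIdeal (heq ▸ hx')
  have hle₁ := (mem_support_iff_stalkIdeal_le _ _).mp hx'
  have hne₁ : stalkIdeal (strictTransformIdeal π (T.sup id) K₁) x' ≠ ⊤ := fun h =>
    (maximalIdeal.isMaximal _).ne_top (top_le_iff.mp (h ▸ hle₁))
  by_cases hxC : π x' ∈ (T.sup id).support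
  · obtain ⟨D, τ, d, v, lab, hτinj, hrsop, hlabinj, -, hcases⟩ :=
      stalkIdeal_strictTransformIdeal_cases_pw hW hT hπ hxC
    haveI := hrsop.isRegularLocalRing
    haveI := isDomain_of_isRegularLocalRing (X'.presheaf.stalk x')
    rcases hcases ⟨K₁, h₁, hx₁⟩ with htop | ⟨l₁, hc₁, hl₁⟩
    · exact absurd htop hne₁
    rcases hcases ⟨K₂, h₂, hx₂⟩ with htop | ⟨l₂, hc₂, hl₂⟩
    · exact absurd (heq ▸ htop) hne₁
    have hll : l₁ = l₂ := by
      by_contra hne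
      rw [heq, hl₂, Ideal.span_singleton_eq_span_singleton] at hl₁
      exact hrsop.not_associated (fun h => hne (Option.some_injective _ (hlabinj h)).symm) hl₁
    subst hll
    have hK := hτinj (hc₁.symm.trans hc₂)
    simpa using congrArg Subtype.val hK
  · -- off the centre: isomorphic stalk maps and distinct stalks below
    haveI := hπ.isIso_stalkMap_of_not_mem_support hxC
    let ε : X.presheaf.stalk (π x') ≃+* X'.presheaf.stalk x' :=
      (asIso (π.stalkMap x')).commRingCatIsoToRingEquiv
    have hε : (ε : X.presheaf.stalk (π x') →+* X'.presheaf.stalk x') = (π.stalkMap x').hom := rfl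
    have hs₁ := stalkIdeal_strictTransformIdeal_of_not_mem_support (π := π) (T.sup id) K₁ hxC
    have hs₂ := stalkIdeal_strictTransformIdeal_of_not_mem_support (π := π) (T.sup id) K₂ hxC
    have hmap : (stalkIdeal K₁ (π x')).map (ε : X.presheaf.stalk (π x') →+* X'.presheaf.stalk x') =
        (stalkIdeal K₂ (π x')).map (ε : X.presheaf.stalk (π x') →+* X'.presheaf.stalk x') := by
      rw [hε, ← hs₁, ← hs₂, heq]
    have hst : stalkIdeal K₁ (π x') = stalkIdeal K₂ (π x') := by
      have h := congrArg (Ideal.map (ε.symm : X'.presheaf.stalk x' →+* X.presheaf.stalk (π x'))) hmap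
      rwa [Ideal.map_of_equiv, Ideal.map_of_equiv] at h
    -- distinct divisors of the boundary through a point of simple normal crossings have distinct stalks
    obtain ⟨hreg, d, u, hd, hu, ⟨ι, hιinj, hι⟩, -⟩ := hx'W
    haveI := hreg
    haveI := isDomain_of_isRegularLocalRing (X.presheaf.stalk (π x'))
    have hrsop : IsRsopPart (u ∘ id) := isRsopPart_comp_of_rsop hd u hu id Function.injective_id
    by_contra hne
    rw [hι ⟨K₁, h₁, hx₁⟩, hι ⟨K₂, h₂, hx₂⟩, Ideal.span_singleton_eq_span_singleton] at hst
    refine hrsop.not_associated (i := ι ⟨K₁, h₁, hx₁⟩) (j := ι ⟨K₂, h₂, hx₂⟩) (fun h => hne ?_) hst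
    exact congrArg Subtype.val (hιinj h)

end Incidence

end PointwisePair

end Summit.ResolutionOfSingularities.ResolutionOfSingularities.Theorems

end
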